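import Mathlib
import Summits.MatrixMultiplication.MatrixMultiplication.Theorems.SubgroupIdentityDesigns.Negative.FamilyA
import Summits.MatrixMultiplication.MatrixMultiplication.Theorems.SubgroupIdentityDesigns.Negative.FamilyADesign

/-!
# Family A carries a level-one identity design for every odd prime — the Borel family is never optimal
(cell B2b-5, crux `SubgroupIdentityDesigns` = stmt-MatrixMultiplication-14079, gen 8; assembles `FamilyA` (the
subgroup triple: TPP, orders, no common eigenvector) and `FamilyADesign` (the universal level-one identity design on
the slice `(g w)₁ = 1`); report `run/shared/lean/b2b/levelgraded-cu/ORACLE-g8.md` §G8-2b).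

For every prime `p ≠ 2` there are subgroups `H₁, H₂, H₃ ≤ GL₂(𝔽_p)` of orders `p−1, 2, p(p−1)` with the subgroup
triple-product property, lying in no common Borel subgroup, of volume `2p(p−1)² > 2(p−1)³` (the volume of the
Borel family F, `BorelFamilyF.borelFamily_card`; the family stays under the PROVEN Borel ceiling `(p−1)³(2+√p)` of
`BorelToralCeiling`), which satisfy the identity-design clause of the crux at level `k = 1` literally.  So at
`(m,k) = (2,1)` the best design-carrying triple is non-Borel for every odd `p`; at `p = 11` this family realises
the census optimum `V*(2,1,11) = 2200` (`PassV2200`, ORACLE-g8 §G8-2).  VALUE = theorem with explicit witness for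
a side question of the cell, NOT summit progress: `m = 2` can never deliver the crux's `ε → 0`, and the crux item
stays open.
-/

set_option linter.dupNamespace false

open Literature.Barriers.MatrixMultiplication (SubgroupTPP)

namespace Summit.MatrixMultiplication.MatrixMultiplication.Theorems.SubgroupIdentityDesigns.Negative
namespace FamilyA

variable (p : ℕ) [Fact p.Prime]

/-- **Family A with its design (all odd primes).**  Subgroups `H₁, H₂, H₃ ≤ GL₂(𝔽_p)` of orders
`p − 1, 2, p(p − 1)`: subgroup TPP, volume `> 2(p−1)³`, no common eigenvector, AND a rank-`≤ 1`-supported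
coefficient table `c` with `Σ_M c_M ψ(tr(M·1)) = 1`, `Σ_M c_M ψ(tr(M·abg)) = 0` for `a ∈ H₁, b ∈ H₂, g ∈ H₃`,
`abg ≠ 1` — the identity-design clause of `SubgroupIdentityDesigns` at `k = 1`, literally. -/
theorem familyA_levelOne_design (hp : p ≠ 2) :
    ∃ H₁ H₂ H₃ : Subgroup (Matrix.GeneralLinearGroup (Fin 2) (ZMod p)),
      SubgroupTPP H₁ H₂ H₃ ∧ Nat.card H₁ = p - 1 ∧ Nat.card H₂ = 2 ∧ Nat.card H₃ = p * (p - 1) ∧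
      2 * (p - 1) ^ 3 < Nat.card H₁ * Nat.card H₂ * Nat.card H₃ ∧
      (∀ v : Fin 2 → ZMod p, v ≠ 0 → ∃ h : Matrix.GeneralLinearGroup (Fin 2) (ZMod p),
        (h ∈ H₁ ∨ h ∈ H₂ ∨ h ∈ H₃) ∧
          ∀ t : ZMod p, (h : Matrix (Fin 2) (Fin 2) (ZMod p)).mulVec v ≠ t • v) ∧
      ∃ c : Matrix (Fin 2) (Fin 2) (ZMod p) → ℂ, (∀ M, 1 < M.rank → c M = 0) ∧
        (∑ M : Matrix (Fin 2) (Fin 2) (ZMod p), c M * ZMod.stdAddChar (Matrix.trace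
          (M * ((1 : Matrix.GeneralLinearGroup (Fin 2) (ZMod p)) : Matrix (Fin 2) (Fin 2) (ZMod p))))) = 1 ∧
        ∀ a ∈ H₁, ∀ b ∈ H₂, ∀ g ∈ H₃, a * b * g ≠ 1 →
          (∑ M : Matrix (Fin 2) (Fin 2) (ZMod p), c M * ZMod.stdAddChar (Matrix.trace
            (M * ((a * b * g : Matrix.GeneralLinearGroup (Fin 2) (ZMod p)) :
              Matrix (Fin 2) (Fin 2) (ZMod p))))) = 0 := by
  refine ⟨H₁ p, H₂ p, H₃ p, tpp p, card_H₁ p, card_H₂ p, card_H₃ p, ?_, nonBorel p hp, ?_⟩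
  · rw [card_H₁, card_H₂, card_H₃]; exact volume_gt p (Nat.Prime.two_le Fact.out)
  · refine FamilyADesign.levelOne_design_of_slice (fun a ha => ⟨ha.1, ha.2.1⟩) (fun b hb => ?_)
      (fun g hg => (mem_H₃ p).1 hg)
    rcases (mem_H₂ p).1 hb with h | h
    · exact Or.inl h
    · exact Or.inr (by rw [h, r_val])

/-- **Corollary: the Borel family is not optimal at `(m,k) = (2,1)` for any odd prime.**  The volume
`2p(p−1)²` of a design-carrying SubgroupTPP triple exceeds `2(p−1)³`. -/
theorem exists_design_volume_gt_borelFamily (hp : p ≠ 2) :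
    ∃ H₁ H₂ H₃ : Subgroup (Matrix.GeneralLinearGroup (Fin 2) (ZMod p)),
      SubgroupTPP H₁ H₂ H₃ ∧ 2 * (p - 1) ^ 3 < Nat.card H₁ * Nat.card H₂ * Nat.card H₃ ∧
      ∃ c : Matrix (Fin 2) (Fin 2) (ZMod p) → ℂ, (∀ M, 1 < M.rank → c M = 0) ∧
        (∑ M : Matrix (Fin 2) (Fin 2) (ZMod p), c M * ZMod.stdAddChar (Matrix.trace
          (M * ((1 : Matrix.GeneralLinearGroup (Fin 2) (ZMod p)) : Matrix (Fin 2) (Fin 2) (ZMod p))))) = 1 ∧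
        ∀ a ∈ H₁, ∀ b ∈ H₂, ∀ g ∈ H₃, a * b * g ≠ 1 →
          (∑ M : Matrix (Fin 2) (Fin 2) (ZMod p), c M * ZMod.stdAddChar (Matrix.trace
            (M * ((a * b * g : Matrix.GeneralLinearGroup (Fin 2) (ZMod p)) :
              Matrix (Fin 2) (Fin 2) (ZMod p))))) = 0 := by
  obtain ⟨H₁, H₂, H₃, htpp, -, -, -, hvol, -, hdes⟩ := familyA_levelOne_design p hp
  exact ⟨H₁, H₂, H₃, htpp, hvol, hdes⟩

end FamilyA
end Summit.MatrixMultiplication.MatrixMultiplication.Theorems.SubgroupIdentityDesigns.Negative
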